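import Summits.CriticalPhenomena.PercolationContinuityZ3.Theorems.PercNearOneGluingNoHeavyLowerTailKNGoodTwoTwoStars
import HarnessLib

/-!
# Hair transfer when the sibling keeps its own hairs (shared ports allowed), and the sure-hair corner of the two-port star
# (`NoHeavyLowerTail` cell, stmt-CriticalPhenomena-4575; prover `prim-hp-2`, deletion–contraction line, gen 8)

Support file (`--supports stmt-CriticalPhenomena-4575`).  No definitions, no named facts, no sorries.

Variants of `KNGoodHairTransfer` for configuration (α) (the siblings `x – {p₁,p₂}` and `y` may SHARE ports): the transferred weighting keeps
`y`'s own pair weights to `p₁, p₂` where `x` holds no sure hair (no hypothesis `u₀ s(y,pᵢ) = 0`):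
* `KNGoodTwoTwo.agood_transfer_corner'`, `KNGoodTwoTwo.agood_transfer_corner_empty'`;
* `KNGoodTwoTwo.agood_xSure_nonneg` — the sure-hair corner of the `x`-torus for an ARBITRARY sibling: if `x` holds a sure hair to a port `c` with
  `μ(j ↔ b) ≤ μ(c ↔ b)` in the split graph, the goodness functional of `x` in the glued graph is `≥ 0` (Kozma–Nitzan Lemma 5 once).
-/

namespace Summit.CriticalPhenomena.PercolationContinuityZ3.Theorems

open MeasureTheory Set ProbabilityTheory Literature.Probability.LatticeModels Literature.Probability.Percolation

noncomputable section
open Classical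

namespace KNGoodTwoTwo
open UpsetExchange KNGoodAux KNGoodSeries KNGoodHair KNGoodLoser

variable {n : ℕ}

/-- **Hair transfer at a sure-hair corner, the sibling keeping its own hairs to the ports of `x` outside `T`.**  `x ≠ y`, ports `p₁ ≠ p₂` distinct from `x, y` and in `A`, `T ⊆ {p₁,p₂}` nonempty;
`g_T`: `x` joined surely to `y` and to the ports of `T`, its other hairs closed; `g'_T`: the same sure hairs held by `y`, `x` isolated.  Then
`agood(g_T, x; j) = agood(g'_T, y; j)` (`j, b ≠ x`). [cite: KozmaNitzan2024, Lemma 5 (p. 13); folklore (contraction of a sure pair)] -/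
theorem agood_transfer_corner' (u₀ : Sym2 (Fin n) → unitInterval) (A T : Finset (Fin n)) (hA : A.Nonempty)
    (x y p₁ p₂ j b : Fin n) (hxy : x ≠ y) (hxp₁ : x ≠ p₁) (hxp₂ : x ≠ p₂) (hyp₁ : y ≠ p₁) (hyp₂ : y ≠ p₂) (hp : p₁ ≠ p₂)
    (hp₁A : p₁ ∈ A) (hp₂A : p₂ ∈ A) (hTsub : T ⊆ {p₁, p₂}) (hT : T.Nonempty) (hjx : j ≠ x) (hbx : b ≠ x)
    (hx0 : ∀ z : Fin n, z ≠ p₁ → z ≠ p₂ → u₀ s(x, z) = 0) :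
    (prodBernoulli (fun f : Sym2 (Fin n) => if f = s(x, p₂) then (if p₂ ∈ T then 1 else 0) else if f = s(x, p₁) then (if p₁ ∈ T then 1 else 0)
        else if f = s(x, y) then 1 else u₀ f)).real (openConn x b) -
      (prodBernoulli (fun f : Sym2 (Fin n) => if f = s(x, p₂) then (if p₂ ∈ T then 1 else 0) else if f = s(x, p₁) then (if p₁ ∈ T then 1 else 0)
        else if f = s(x, y) then 1 else u₀ f)).real (openConn j b) +
      ∑ W ∈ nullSets A, (prodBernoulli (fun f : Sym2 (Fin n) => if f = s(x, p₂) then (if p₂ ∈ T then 1 else 0)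
          else if f = s(x, p₁) then (if p₁ ∈ T then 1 else 0) else if f = s(x, y) then 1 else u₀ f)).real (clusterIs x W) *
        A.inf' hA (fun a => (prodBernoulli (fun f : Sym2 (Fin n) => if f = s(x, p₂) then (if p₂ ∈ T then 1 else 0)
          else if f = s(x, p₁) then (if p₁ ∈ T then 1 else 0) else if f = s(x, y) then 1 else u₀ f)).real (openConnIn ((↑W : Set (Fin n))ᶜ) a b)) =
    (prodBernoulli (fun f : Sym2 (Fin n) => if f = s(y, p₂) then (if p₂ ∈ T then 1 else u₀ s(y, p₂)) else if f = s(y, p₁) then (if p₁ ∈ T then 1 else u₀ s(y, p₁))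
        else if x ∈ f then 0 else u₀ f)).real (openConn y b) -
      (prodBernoulli (fun f : Sym2 (Fin n) => if f = s(y, p₂) then (if p₂ ∈ T then 1 else u₀ s(y, p₂)) else if f = s(y, p₁) then (if p₁ ∈ T then 1 else u₀ s(y, p₁))
        else if x ∈ f then 0 else u₀ f)).real (openConn j b) +
      ∑ W ∈ nullSets A, (prodBernoulli (fun f : Sym2 (Fin n) => if f = s(y, p₂) then (if p₂ ∈ T then 1 else u₀ s(y, p₂))
          else if f = s(y, p₁) then (if p₁ ∈ T then 1 else u₀ s(y, p₁)) else if x ∈ f then 0 else u₀ f)).real (clusterIs y W) *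
        A.inf' hA (fun a => (prodBernoulli (fun f : Sym2 (Fin n) => if f = s(y, p₂) then (if p₂ ∈ T then 1 else u₀ s(y, p₂))
          else if f = s(y, p₁) then (if p₁ ∈ T then 1 else u₀ s(y, p₁)) else if x ∈ f then 0 else u₀ f)).real (openConnIn ((↑W : Set (Fin n))ᶜ) a b)) := by
  set gT : Sym2 (Fin n) → unitInterval := fun f => if f = s(x, p₂) then (if p₂ ∈ T then 1 else 0)
    else if f = s(x, p₁) then (if p₁ ∈ T then 1 else 0) else if f = s(x, y) then 1 else u₀ f with hgT
  set g'T : Sym2 (Fin n) → unitInterval := fun f => if f = s(y, p₂) then (if p₂ ∈ T then 1 else u₀ s(y, p₂))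
    else if f = s(y, p₁) then (if p₁ ∈ T then 1 else u₀ s(y, p₁)) else if x ∈ f then 0 else u₀ f with hg'T
  -- a sure port
  obtain ⟨t, htT⟩ := hT
  have htP : t = p₁ ∨ t = p₂ := by simpa using hTsub htT
  have htA : t ∈ A := by rcases htP with rfl | rfl <;> assumption
  have htx : t ≠ x := by rcases htP with rfl | rfl <;> [exact hxp₁.symm; exact hxp₂.symm]
  have hty : t ≠ y := by rcases htP with rfl | rfl <;> [exact hyp₁.symm; exact hyp₂.symm]
  -- evaluations
  have hg_xy : gT s(x, y) = 1 := by simp [hgT, hyp₂, hyp₁, hxp₂, hxp₁]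
  have hg_xt : ∀ t' ∈ T, gT s(x, t') = 1 := by
    intro t' ht'
    have : t' = p₁ ∨ t' = p₂ := by simpa using hTsub ht'
    rcases this with rfl | rfl
    · simp [hgT, hp, ht', hxp₂]
    · simp [hgT, ht']
  have hg'_iso : ∀ u : Fin n, u ≠ x → g'T s(x, u) = 0 := by
    intro u _
    simp [hg'T, hxy, hxp₁, hxp₂]
  have hg'_yt : ∀ t' ∈ T, g'T s(y, t') = 1 := by
    intro t' ht'
    have : t' = p₁ ∨ t' = p₂ := by simpa using hTsub ht'
    rcases this with rfl | rfl
    · simp [hg'T, hp, ht', hyp₂]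
    · simp [hg'T, ht']
  -- the pendant attachment of `x` to `y` over `g'T`
  set m : Sym2 (Fin n) → unitInterval := fun f => if f = s(x, y) then 1 else g'T f with hm
  have hm_yx : m s(y, x) = 1 := by simp [hm, Sym2.eq_swap]
  have hm_yt : ∀ t' ∈ T, m s(y, t') = 1 := by
    intro t' ht'
    have ht'x : t' ≠ x := by
      have : t' = p₁ ∨ t' = p₂ := by simpa using hTsub ht'
      rcases this with rfl | rfl; exacts [hxp₁.symm, hxp₂.symm]
    have hne : s(y, t') ≠ s(x, y) := by
      intro h; rcases Sym2.eq_iff.1 h with ⟨h1, _⟩ | ⟨_, h2⟩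
      · exact hxy h1.symm
      · exact ht'x h2
    rw [hm]; simp only; rw [if_neg hne]; exact hg'_yt t' ht'
  have hm1 : ∀ z b' : Fin n, z ≠ x → b' ≠ x → (prodBernoulli m).real (openConn z b') = (prodBernoulli g'T).real (openConn z b') :=
    fun z b' hz hb' => real_openConn_attachPendant g'T x y hxy hg'_iso z b' hz hb'
  have hm2 : (prodBernoulli m).real (openConn x b) = (prodBernoulli g'T).real (openConn y b) :=
    real_openConn_attachPendant_self g'T x y hxy hg'_iso b hbx
  -- the common refinement
  set D₁ : Finset (Sym2 (Fin n)) := T.image (fun t' => s(x, t')) with hD₁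
  set D₂ : Finset (Sym2 (Fin n)) := T.image (fun t' => s(y, t')) with hD₂
  set R₁ : Sym2 (Fin n) → unitInterval := fun f => if f ∈ D₁ then 1 else m f with hR₁
  set R₂ : Sym2 (Fin n) → unitInterval := fun f => if f ∈ D₂ then 1 else gT f with hR₂
  have hD₁mem : ∀ f, f ∈ D₁ ↔ ∃ t' ∈ T, s(x, t') = f := fun f => by rw [hD₁, Finset.mem_image]
  have hD₂mem : ∀ f, f ∈ D₂ ↔ ∃ t' ∈ T, s(y, t') = f := fun f => by rw [hD₂, Finset.mem_image]
  have hTx : ∀ t' ∈ T, t' ≠ x ∧ t' ≠ y := by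
    intro t' ht'
    have : t' = p₁ ∨ t' = p₂ := by simpa using hTsub ht'
    rcases this with rfl | rfl
    · exact ⟨hxp₁.symm, hyp₁.symm⟩
    · exact ⟨hxp₂.symm, hyp₂.symm⟩
  have hRel₁ : ∀ z, (prodBernoulli R₁).real (openConn z b) = (prodBernoulli m).real (openConn z b) := by
    intro z
    refine real_openConn_gluePairs_of_asJoined m D₁ (fun e he a ha c hc => ?_) z b
    obtain ⟨t', ht', rfl⟩ := (hD₁mem e).1 he
    have key : (prodBernoulli m).real (openConn x t')ᶜ = 0 :=
      real_not_openConn_eq_zero_of_hub m y x t' hxy (hTx t' ht').2 hm_yx (hm_yt t' ht')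
    rcases Sym2.mem_iff.1 ha with rfl | rfl <;> rcases Sym2.mem_iff.1 hc with rfl | rfl
    · exact real_compl_openConn_self m _
    · exact key
    · rw [openConn_comm]; exact key
    · exact real_compl_openConn_self m _
  have hRel₂ : ∀ z, (prodBernoulli R₂).real (openConn z b) = (prodBernoulli gT).real (openConn z b) := by
    intro z
    refine real_openConn_gluePairs_of_asJoined gT D₂ (fun e he a ha c hc => ?_) z b
    obtain ⟨t', ht', rfl⟩ := (hD₂mem e).1 he
    have key : (prodBernoulli gT).real (openConn y t')ᶜ = 0 :=
      real_not_openConn_eq_zero_of_hub gT x y t' hxy.symm (hTx t' ht').1 hg_xy (hg_xt t' ht')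
    rcases Sym2.mem_iff.1 ha with rfl | rfl <;> rcases Sym2.mem_iff.1 hc with rfl | rfl
    · exact real_compl_openConn_self gT _
    · exact key
    · rw [openConn_comm]; exact key
    · exact real_compl_openConn_self gT _
  have hR : R₁ = R₂ := by
    funext f
    rw [hR₁, hR₂]; simp only
    by_cases hf1 : f ∈ D₁
    · obtain ⟨t', ht', rfl⟩ := (hD₁mem f).1 hf1
      have hnot : s(x, t') ∉ D₂ := by
        intro h
        obtain ⟨t'', ht'', h''⟩ := (hD₂mem _).1 h
        rcases Sym2.eq_iff.1 h'' with ⟨h1, _⟩ | ⟨_, h2⟩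
        · exact hxy h1.symm
        · exact (hTx t'' ht'').1 h2
      rw [if_pos hf1, if_neg hnot, hg_xt t' ht']
    · rw [if_neg hf1]
      by_cases hf2 : f ∈ D₂
      · obtain ⟨t', ht', rfl⟩ := (hD₂mem f).1 hf2
        rw [if_pos hf2, hm_yt t' ht']
      · rw [if_neg hf2]
        by_cases hf3 : f = s(x, y)
        · subst hf3
          rw [hg_xy]; simp [hm]
        · have hmf : m f = g'T f := by rw [hm]; simp only; rw [if_neg hf3]
          rw [hmf]
          by_cases hfx2 : f = s(x, p₂)
          · subst hfx2
            have hp₂T : p₂ ∉ T := fun h => hf1 ((hD₁mem _).2 ⟨p₂, h, rfl⟩)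
            rw [hg'_iso p₂ hxp₂.symm]
            simp [hgT, hp₂T]
          · by_cases hfx1 : f = s(x, p₁)
            · subst hfx1
              have hp₁T : p₁ ∉ T := fun h => hf1 ((hD₁mem _).2 ⟨p₁, h, rfl⟩)
              rw [hg'_iso p₁ hxp₁.symm]
              simp [hgT, hp₁T, hp, hxp₂]
            · by_cases hfy2 : f = s(y, p₂)
              · subst hfy2
                have hp₂T : p₂ ∉ T := fun h => hf2 ((hD₂mem _).2 ⟨p₂, h, rfl⟩)
                have e1 : g'T s(y, p₂) = u₀ s(y, p₂) := by simp [hg'T, hp₂T]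
                have e2 : gT s(y, p₂) = u₀ s(y, p₂) := by
                  simp [hgT, hxy.symm, hxp₂.symm, hyp₁, hyp₂]
                rw [e1, e2]
              · by_cases hfy1 : f = s(y, p₁)
                · subst hfy1
                  have hp₁T : p₁ ∉ T := fun h => hf2 ((hD₂mem _).2 ⟨p₁, h, rfl⟩)
                  have e1 : g'T s(y, p₁) = u₀ s(y, p₁) := by simp [hg'T, hp₁T, hp, hyp₂]
                  have e2 : gT s(y, p₁) = u₀ s(y, p₁) := by
                    simp [hgT, hxy.symm, hxp₁.symm, hyp₁, hyp₂, hp]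
                  rw [e1, e2]
                · have e1 : g'T f = if x ∈ f then 0 else u₀ f := by
                    rw [hg'T]; simp only; rw [if_neg hfy2, if_neg hfy1]
                  have e2 : gT f = u₀ f := by
                    rw [hgT]; simp only; rw [if_neg hfx2, if_neg hfx1, if_neg hf3]
                  rw [e1, e2]
                  by_cases hx : x ∈ f
                  · rw [if_pos hx]
                    have hof := Sym2.other_spec hx
                    have hz1 : Sym2.Mem.other hx ≠ p₁ := fun h => hfx1 (by rw [← hof, h])
                    have hz2 : Sym2.Mem.other hx ≠ p₂ := fun h => hfx2 (by rw [← hof, h])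
                    rw [← hof, hx0 _ hz1 hz2]
                  · rw [if_neg hx]
  -- reliabilities
  have ex : (prodBernoulli gT).real (openConn x b) = (prodBernoulli g'T).real (openConn y b) := by
    rw [← hRel₂ x, ← hR, hRel₁ x, hm2]
  have ej : (prodBernoulli gT).real (openConn j b) = (prodBernoulli g'T).real (openConn j b) := by
    rw [← hRel₂ j, ← hR, hRel₁ j, hm1 j b hjx hbx]
  -- correction sums vanish on both sides
  have hDx := sum_clusterIs_eq_zero_of_surePair gT A hA x t b htA htx.symm (hg_xt t htT)
  have hDy := sum_clusterIs_eq_zero_of_surePair g'T A hA y t b htA hty.symm (hg'_yt t htT)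
  rw [hDx, hDy, ex, ej]

/-- **Hair transfer at the hairless corner, the sibling keeping all its own hairs**: `x` joined surely to `y` only is the observer `y` of the graph without `x`
(`KNGoodSeriesGlue.agood_wzero_glue_one`). [folklore] -/
theorem agood_transfer_corner_empty' (u₀ : Sym2 (Fin n) → unitInterval) (A : Finset (Fin n)) (hA : A.Nonempty)
    (x y p₁ p₂ j b : Fin n) (hxy : x ≠ y) (hxp₁ : x ≠ p₁) (hxp₂ : x ≠ p₂) (hyp₁ : y ≠ p₁) (hyp₂ : y ≠ p₂)
    (hxA : x ∉ A) (hjA : j ∈ A) (hbx : b ≠ x)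
    (hx0 : ∀ z : Fin n, z ≠ p₁ → z ≠ p₂ → u₀ s(x, z) = 0) :
    (prodBernoulli (fun f : Sym2 (Fin n) => if f = s(x, p₂) then 0 else if f = s(x, p₁) then 0
        else if f = s(x, y) then 1 else u₀ f)).real (openConn x b) -
      (prodBernoulli (fun f : Sym2 (Fin n) => if f = s(x, p₂) then 0 else if f = s(x, p₁) then 0
        else if f = s(x, y) then 1 else u₀ f)).real (openConn j b) +
      ∑ W ∈ nullSets A, (prodBernoulli (fun f : Sym2 (Fin n) => if f = s(x, p₂) then 0
          else if f = s(x, p₁) then 0 else if f = s(x, y) then 1 else u₀ f)).real (clusterIs x W) *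
        A.inf' hA (fun a => (prodBernoulli (fun f : Sym2 (Fin n) => if f = s(x, p₂) then 0
          else if f = s(x, p₁) then 0 else if f = s(x, y) then 1 else u₀ f)).real (openConnIn ((↑W : Set (Fin n))ᶜ) a b)) =
    (prodBernoulli (fun f : Sym2 (Fin n) => if x ∈ f then 0 else u₀ f)).real (openConn y b) -
      (prodBernoulli (fun f : Sym2 (Fin n) => if x ∈ f then 0 else u₀ f)).real (openConn j b) +
      ∑ W ∈ nullSets A, (prodBernoulli (fun f : Sym2 (Fin n) => if x ∈ f then 0 else u₀ f)).real (clusterIs y W) *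
        A.inf' hA (fun a => (prodBernoulli (fun f : Sym2 (Fin n) => if x ∈ f then 0 else u₀ f)).real (openConnIn ((↑W : Set (Fin n))ᶜ) a b)) := by
  set g : Sym2 (Fin n) → unitInterval := fun f => if f = s(x, p₂) then 0 else if f = s(x, p₁) then 0
    else if f = s(x, y) then 1 else u₀ f with hg
  set g' : Sym2 (Fin n) → unitInterval := fun f => if x ∈ f then 0 else u₀ f with hg'
  have hpin : pinW g' {e : Sym2 (Fin n) | x ∈ e ∧ ¬ e.IsDiag} ∅ = g' := by
    funext f
    rw [pinW_apply]
    by_cases hf : f ∈ {e : Sym2 (Fin n) | x ∈ e ∧ ¬ e.IsDiag}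
    · rw [if_pos hf, if_neg (Set.notMem_empty _)]
      have hxf : x ∈ f := hf.1
      symm
      rw [hg']; simp only; rw [if_pos hxf]
    · rw [if_neg hf]
  have hupd : Function.update (pinW g' {e : Sym2 (Fin n) | x ∈ e ∧ ¬ e.IsDiag} ∅) s(x, y) 1 = g := by
    rw [hpin]
    funext f
    rw [Function.update_apply]
    by_cases hf : f = s(x, y)
    · subst hf
      rw [if_pos rfl, hg]; simp [hyp₂, hyp₁, hxp₂, hxp₁]
    · rw [if_neg hf]
      by_cases hfx2 : f = s(x, p₂)
      · subst hfx2
        have e1 : g' s(x, p₂) = 0 := by simp [hg']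
        have e2 : g s(x, p₂) = 0 := by simp [hg]
        rw [e1, e2]
      · by_cases hfx1 : f = s(x, p₁)
        · subst hfx1
          have e1 : g' s(x, p₁) = 0 := by simp [hg']
          have e2 : g s(x, p₁) = 0 := by simp [hg]
          rw [e1, e2]
        · have e1 : g' f = if x ∈ f then 0 else u₀ f := by rw [hg']
          have e2 : g f = u₀ f := by
            rw [hg]; simp only; rw [if_neg hfx2, if_neg hfx1, if_neg hf]
          rw [e1, e2]
          by_cases hx : x ∈ f
          · rw [if_pos hx]
            have hof := Sym2.other_spec hx
            have hz1 : Sym2.Mem.other hx ≠ p₁ := fun h => hfx1 (by rw [← hof, h])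
            have hz2 : Sym2.Mem.other hx ≠ p₂ := fun h => hfx2 (by rw [← hof, h])
            rw [← hof, hx0 _ hz1 hz2]
          · rw [if_neg hx]
  have h := agood_wzero_glue_one g' A hA x y j b hxA hxy.symm hjA hbx
  rw [hupd, hpin] at h
  exact h

/-- **The sure-hair corner of the `x`-torus, arbitrary sibling.**  See the module docstring. [cite: KozmaNitzan2024, Lemma 5 (p. 13)] -/
theorem agood_xSure_nonneg (u₁ : Sym2 (Fin n) → unitInterval) (A : Finset (Fin n)) (hA : A.Nonempty)
    (x y c j b : Fin n) (hxy : x ≠ y) (hxc : x ≠ c) (hsure : u₁ s(x, c) = 1)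
    (hrow : (prodBernoulli u₁).real (openConn j b) ≤ (prodBernoulli u₁).real (openConn c b)) :
    0 ≤ (prodBernoulli (Function.update u₁ s(x, y) 1)).real (openConn x b) -
        (prodBernoulli (Function.update u₁ s(x, y) 1)).real (openConn j b) +
        ∑ W ∈ nullSets A, (prodBernoulli (Function.update u₁ s(x, y) 1)).real (clusterIs x W) *
          A.inf' hA (fun a => (prodBernoulli (Function.update u₁ s(x, y) 1)).real (openConnIn ((↑W : Set (Fin n))ᶜ) a b)) := by
  have hu : Function.update u₁ s(x, c) 1 = u₁ := by rw [← hsure, Function.update_eq_self]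
  have hxc' : (prodBernoulli u₁).real (openConn c b) = (prodBernoulli u₁).real (openConn x b) := by
    have h := real_openConn_update_one_glued u₁ x c b hxc
    rw [hu] at h; exact h
  have hle : (prodBernoulli u₁).real (openConn j b) ≤ (prodBernoulli u₁).real (openConn x b) := hxc' ▸ hrow
  have hglue := glueTransfer_openConn u₁ y x j b (Ne.symm hxy) hle
  rw [Sym2.eq_swap] at hglue
  have hyx : (prodBernoulli (Function.update u₁ s(x, y) 1)).real (openConn y b) =
      (prodBernoulli (Function.update u₁ s(x, y) 1)).real (openConn x b) := real_openConn_update_one_glued u₁ x y b hxy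
  rw [hyx] at hglue
  have hD : 0 ≤ ∑ W ∈ nullSets A, (prodBernoulli (Function.update u₁ s(x, y) 1)).real (clusterIs x W) *
      A.inf' hA (fun a => (prodBernoulli (Function.update u₁ s(x, y) 1)).real (openConnIn ((↑W : Set (Fin n))ᶜ) a b)) :=
    Finset.sum_nonneg fun W _ => mul_nonneg measureReal_nonneg ((Finset.le_inf'_iff hA _).2 fun a _ => measureReal_nonneg)
  linarith

end KNGoodTwoTwo

end

end Summit.CriticalPhenomena.PercolationContinuityZ3.Theorems
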